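import Summits.FinalStateConjecture.FinalStateConjecture.Theorems.PhotonSphereChannelsBlindnessWavePicard
import Summits.FinalStateConjecture.FinalStateConjecture.Theorems.PhotonSphereChannelsBlindnessWaveRegularity
import Summits.FinalStateConjecture.FinalStateConjecture.Theorems.PhotonSphereChannelsBlindnessWaveTransfer

/-!
# Route PhotonSphereChannels · BlindnessInsidePhotonSphere — the 1+1 wave equation with a
# potential, IV: global even `C²` solutions with compactly supported data

Support file (pure analysis, everything proved) for item stmt-FinalStateConjecture-10049.
**Theorem** (`exists_even_solution`). Let `V ∈ C¹(ℝ)` be bounded and `A ∈ C²(ℝ)` vanish off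
`[α, β]`. Then there is `ψ ∈ C²(ℝ²)` with

* `ψ_tt − ψ_xx + V(x) ψ = 0` everywhere (in the `iteratedDeriv` form of the route statement),
* `ψ(0, ·) = A`, `ψ_t(0, ·) = 0`, `ψ(−t, x) = ψ(t, x)`,
* `ψ(t, x) = 0` whenever `x < α − |t|` or `x > β + |t|` (domain of influence).

Proof: null coordinates `a = x + t`, `b = x − t`, `c(a,b) = V((a+b)/2)/4`; Picard's fixed point
for the characteristic Volterra pair (`exists_picard_fixedPoint`), the `C²` bootstrap
(`contDiff_two_psi`, `hasFDerivAt_psi`, `fderiv_P_snd`, `fderiv_Q_fst`), swap-symmetrisation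
(`symmetrise`) and the chain rule back to `(t, x)` (`iteratedDeriv_two_time_sub_space`)
(Courant–Hilbert II, Ch. V §5). No definitions are introduced.
-/

noncomputable section

open Set Filter MeasureTheory intervalIntegral Topology Function

namespace Summit.FinalStateConjecture.FinalStateConjecture.Theorems.Blindness

/-- A continuous function vanishing off a compact interval is bounded. -/
theorem exists_abs_le_of_eq_zero_off {f : ℝ → ℝ} (hf : Continuous f) {α β : ℝ}
    (h0 : ∀ x, x ∉ Icc α β → f x = 0) : ∃ M, ∀ x, |f x| ≤ M := by
  obtain ⟨M, hM⟩ := (isCompact_Icc (a := α) (b := β)).exists_bound_of_continuousOn hf.continuousOn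
  refine ⟨max M 0, fun x => ?_⟩
  by_cases hx : x ∈ Icc α β
  · exact (le_of_eq (Real.norm_eq_abs _).symm).trans ((hM x hx).trans (le_max_left _ _))
  · rw [h0 x hx, abs_zero]; exact le_max_right _ _

/-- The derivative of a function vanishing off `[α, β]` vanishes at `b ∉ [α, β]`. -/
theorem deriv_eq_zero_off {f : ℝ → ℝ} {α β b : ℝ} (h0 : ∀ x, x ∉ Icc α β → f x = 0)
    (hb : b < α ∨ β < b) : deriv f b = 0 := by
  have hev : f =ᶠ[𝓝 b] fun _ => (0 : ℝ) := by
    rcases hb with hb | hb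
    · filter_upwards [Iio_mem_nhds hb] with x hx
      exact h0 x fun h => (not_le.2 hx) h.1
    · filter_upwards [Ioi_mem_nhds hb] with x hx
      exact h0 x fun h => (not_le.2 hx) h.2
  rw [hev.deriv_eq, deriv_const]

/-- **Global even `C²` solutions of `ψ_tt − ψ_xx + Vψ = 0` with compactly supported data.** -/
theorem exists_even_solution {V A : ℝ → ℝ} {CV α β : ℝ} (hV : ContDiff ℝ 1 V)
    (hVb : ∀ x, |V x| ≤ CV) (hA : ContDiff ℝ 2 A) (hA0 : ∀ x, x ∉ Icc α β → A x = 0) :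
    ∃ ψ : ℝ → ℝ → ℝ, ContDiff ℝ 2 (uncurry ψ) ∧
      (∀ t x, iteratedDeriv 2 (fun τ => ψ τ x) t - iteratedDeriv 2 (ψ t) x + V x * ψ t x = 0) ∧
      (∀ x, ψ 0 x = A x) ∧ (∀ x, deriv (fun τ => ψ τ x) 0 = 0) ∧
      (∀ t x, ψ (-t) x = ψ t x) ∧
      (∀ t x, (x < α - |t| ∨ β + |t| < x) → ψ t x = 0) := by
  -- the coefficient in null coordinates
  set c : ℝ → ℝ → ℝ := fun a b => V ((a + b) / 2) / 4 with hc_def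
  have hc : ContDiff ℝ 1 (uncurry c) := by
    show ContDiff ℝ 1 fun p : ℝ × ℝ => V ((p.1 + p.2) / 2) / 4
    exact (hV.comp ((contDiff_fst.add contDiff_snd).div_const 2)).div_const 4
  have hcc : Continuous (uncurry c) := hc.continuous
  have hcb : ∀ a b, |c a b| ≤ CV / 4 := fun a b => by
    rw [hc_def]; dsimp only; rw [abs_div, abs_of_pos (by norm_num : (0:ℝ) < 4)]
    exact div_le_div_of_nonneg_right (hVb _) (by norm_num)
  -- bounds on the data
  have hA' : ContDiff ℝ 1 (deriv A) := contDiff_one_deriv_of_two hA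
  have hA'0 : ∀ b, (b < α ∨ β < b) → deriv A b = 0 := fun b hb => deriv_eq_zero_off hA0 hb
  obtain ⟨MA, hMA⟩ := exists_abs_le_of_eq_zero_off hA.continuous hA0
  obtain ⟨MA', hMA'⟩ := exists_abs_le_of_eq_zero_off hA'.continuous (α := α) (β := β)
    (fun x hx => hA'0 x (by
      by_contra h
      exact hx ⟨le_of_not_gt fun h' => h (Or.inl h'), le_of_not_gt fun h' => h (Or.inr h')⟩))
  -- the complement of the characteristic domain of influence of `[α, β]`
  set Z : Set (ℝ × ℝ) := {p | (p.2 ≤ p.1 ∧ (p.1 < α ∨ β < p.2)) ∨ (p.1 ≤ p.2 ∧ (p.2 < α ∨ β < p.1))}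
    with hZ
  have hZA : ∀ p ∈ Z, A p.1 = 0 := by
    rintro ⟨a, b⟩ hp
    apply hA0
    rintro ⟨h1, h2⟩
    rcases hp with ⟨hba, h | h⟩ | ⟨hab, h | h⟩ <;> dsimp only at * <;> linarith
  have hZA' : ∀ p ∈ Z, deriv A p.2 = 0 := by
    rintro ⟨a, b⟩ hp
    apply hA'0
    rcases hp with ⟨hba, h | h⟩ | ⟨hab, h | h⟩ <;> dsimp only at *
    · left; linarith
    · right; linarith
    · left; linarith
    · right; linarith
  have hZ1 : ∀ p ∈ Z, ∀ s ∈ uIcc p.2 p.1, (p.1, s) ∈ Z := by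
    rintro ⟨a, b⟩ hp s hs
    rcases hp with ⟨hba, h | h⟩ | ⟨hab, h | h⟩ <;> dsimp only at *
    · rw [uIcc_of_le hba] at hs; exact Or.inl ⟨hs.2, Or.inl h⟩
    · rw [uIcc_of_le hba] at hs; exact Or.inl ⟨hs.2, Or.inr (lt_of_lt_of_le h hs.1)⟩
    · rw [uIcc_of_ge hab] at hs; exact Or.inr ⟨hs.1, Or.inl (lt_of_le_of_lt hs.2 h)⟩
    · rw [uIcc_of_ge hab] at hs; exact Or.inr ⟨hs.1, Or.inr h⟩
  have hZ2 : ∀ p ∈ Z, ∀ s ∈ uIcc p.2 p.1, (s, p.2) ∈ Z := by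
    rintro ⟨a, b⟩ hp s hs
    rcases hp with ⟨hba, h | h⟩ | ⟨hab, h | h⟩ <;> dsimp only at *
    · rw [uIcc_of_le hba] at hs; exact Or.inl ⟨hs.1, Or.inl (lt_of_le_of_lt hs.2 h)⟩
    · rw [uIcc_of_le hba] at hs; exact Or.inl ⟨hs.1, Or.inr h⟩
    · rw [uIcc_of_ge hab] at hs; exact Or.inr ⟨hs.2, Or.inl h⟩
    · rw [uIcc_of_ge hab] at hs; exact Or.inr ⟨hs.2, Or.inr (lt_of_lt_of_le h hs.1)⟩
  have hZsw : ∀ p : ℝ × ℝ, p ∈ Z → (p.2, p.1) ∈ Z := by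
    rintro ⟨a, b⟩ hp
    rcases hp with ⟨hba, h⟩ | ⟨hab, h⟩
    · exact Or.inr ⟨hba, h⟩
    · exact Or.inl ⟨hab, h⟩
  -- Picard
  obtain ⟨Ψ, Q, hΨc, hQc, hΨ, hQ, hZ0⟩ := exists_picard_fixedPoint (A := A) (A' := deriv A) hcc hcb
    hA.continuous hA'.continuous hMA hMA' Z hZA hZA' hZ1 hZ2
  -- the bootstrap package
  set U : ℝ × ℝ → ℝ := uncurry Ψ with hU
  set Pf : ℝ × ℝ → ℝ := fun p => deriv A p.1 - Q p.1 p.1 - ∫ s in p.2..p.1, c p.1 s * Ψ p.1 s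
    with hPf
  set Qf : ℝ × ℝ → ℝ := uncurry Q with hQf
  set cc : ℝ × ℝ → ℝ := fun p => c p.1 p.2 with hcc_def
  have hU2 : ContDiff ℝ 2 U := contDiff_two_psi hc hA hΨc hQc hΨ hQ
  have hP1 : ContDiff ℝ 1 Pf := contDiff_one_P hc hA hΨc hQc hΨ hQ
  have hQ1 : ContDiff ℝ 1 Qf := contDiff_one_Q hc hA hΨc hQc hΨ hQ
  have hUd : ∀ p, HasFDerivAt U ((Pf p) • ContinuousLinearMap.fst ℝ ℝ ℝ +
      (Qf p) • ContinuousLinearMap.snd ℝ ℝ ℝ) p := fun p =>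
    hasFDerivAt_psi hc hA hΨc hQc hΨ hQ p
  have hPb : ∀ p, fderiv ℝ Pf p (0, 1) = cc p * U p := fun p =>
    fderiv_P_snd hc hA hΨc hQc hΨ hQ p
  have hQa : ∀ p, fderiv ℝ Qf p (1, 0) = cc p * U p := fun p =>
    fderiv_Q_fst hc hA hΨc hQc hΨ hQ p
  have hcs : ∀ p : ℝ × ℝ, cc (p.2, p.1) = cc p := fun p => by
    simp only [hcc_def, hc_def, add_comm]
  -- symmetrise
  obtain ⟨hU2', hP1', hQ1', hUd', hPb', hQa'⟩ := symmetrise hU2 hP1 hQ1 hUd hPb hQa hcs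
  -- the solution
  set U' : ℝ × ℝ → ℝ := fun p => 2⁻¹ * (U p + U (p.2, p.1)) with hU'
  refine ⟨fun t x => U' (x + t, x - t), contDiff_two_transfer hU2', ?_, ?_, ?_, ?_, ?_⟩
  · -- the equation
    intro t x
    have h := iteratedDeriv_two_time_sub_space (U := U') hP1' hQ1' hUd' hPb' hQa' t x
    have hcx : cc (x + t, x - t) = V x / 4 := by
      simp only [hcc_def, hc_def]
      congr 2; ring
    rw [hcx] at h
    have h' : iteratedDeriv 2 (fun τ => U' (x + τ, x - τ)) t
        - iteratedDeriv 2 (fun y => U' (y + t, y - t)) x = -(V x * U' (x + t, x - t)) := by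
      rw [h]; ring
    show iteratedDeriv 2 (fun τ => U' (x + τ, x - τ)) t
        - iteratedDeriv 2 (fun y => U' (y + t, y - t)) x + V x * U' (x + t, x - t) = 0
    rw [h']; ring
  · -- `ψ(0, ·) = A`
    intro x
    show 2⁻¹ * (U (x + 0, x - 0) + U ((x + 0, x - 0).2, (x + 0, x - 0).1)) = A x
    simp only [add_zero, sub_zero, hU, uncurry_apply_pair, hΨ x x, intervalIntegral.integral_same,
      sub_zero]
    ring
  · -- `ψ_t(0, ·) = 0`
    intro x
    have h := hasDerivAt_transfer_time hUd' (0 : ℝ) x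
    rw [h.deriv]
    simp only [add_zero, sub_zero]
    ring
  · -- evenness
    intro t x
    show 2⁻¹ * (U (x + -t, x - -t) + U ((x + -t, x - -t).2, (x + -t, x - -t).1))
      = 2⁻¹ * (U (x + t, x - t) + U ((x + t, x - t).2, (x + t, x - t).1))
    simp only [← sub_eq_add_neg, sub_neg_eq_add]
    ring
  · -- domain of influence
    intro t x hx
    have hmem : (x + t, x - t) ∈ Z := by
      rcases le_or_gt 0 t with ht | ht
      · rw [abs_of_nonneg ht] at hx
        refine Or.inl ⟨by linarith, ?_⟩
        rcases hx with hx | hx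
        · left; linarith
        · right; linarith
      · rw [abs_of_neg ht] at hx
        refine Or.inr ⟨by linarith, ?_⟩
        rcases hx with hx | hx
        · left; linarith
        · right; linarith
    have h1 : U (x + t, x - t) = 0 := (hZ0 _ hmem).1
    have h2 : U (x - t, x + t) = 0 := (hZ0 _ (hZsw _ hmem)).1
    show 2⁻¹ * (U (x + t, x - t) + U ((x + t, x - t).2, (x + t, x - t).1)) = 0
    simp [h1, h2]

end Summit.FinalStateConjecture.FinalStateConjecture.Theorems.Blindness

end
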